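import Literature.NumberTheory.EllipticCurves.Sprung2017.SharpFlatPAdicLFunction
import HarnessLib

/-!
# Sprung's ♯/♭ `p`-adic `L`-functions at `a_p = 0` ARE Pollack's `L^±` (same labelling):
# the Mazur–Tate characterisation `IsSprungPair` versus the tree's Pollack fact
# (cell `b2b-bsdres`, supersingular family, prover B = unit `b2b-bsdres-additive-p3`, gen 3)

HONEST FRAMING (run/shared/lean/b2b/bsd-rank1-residual/, verbatim in every file): the goal of the
cell is to DELETE the COMBINATION-SHAPED residual classes of the Birch–Swinnerton-Dyer formula for
ALL analytic-rank `≤ 1` elliptic curves over `ℚ` — "full BSD formula for every rank `≤ 1` curve in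
class `C`" assembled STRICTLY from published theorems — so that the rank-`≤ 1` remainder becomes
exactly the CONSTRUCTION-SHAPED classes, which are TYPED (missing-input `Prop`s), NOT attempted.
This is not "finishing BSD". THEOREMS ONLY (no definition, no named fact, nothing about any curve is
asserted); no label of the cell moves (X8 stays CONSTRUCTION-SHAPED).

## What this file does

`Literature/NumberTheory/EllipticCurves/Sprung2017/SharpFlatPAdicLFunction.lean` (p212436) vendors
Sprung's ♯/♭ `p`-adic `L`-functions (Sprung, Algebra Number Theory 11 (2017), Thm. 1.12 with
Cor. 4.4–4.5) in their Mazur–Tate form: `IsSprungPair f p a_p L♯ L♭` ⟺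
`θ_n ≡ −(u_n L♯ + v_n L♭) (mod ω_n)` in `Λ ⊗ ℚ_p` for all `n`, with the recursion polynomials
`u_n = sharpPoly`, `v_n = flatPoly` (`x_n = a_p x_{n−1} − Φ_{p^{n−1}}(1+T) x_{n−2}`). This file PROVES
the first of the two consistency statements announced there:

* `toIwasawa_apply`, `isCongrModOmega_congr`, `constantCoeff_toIwasawa_mul` — plumbing: transport
  of a congruence `θ ≡ ω L (mod ω_n)` along `ω L = ω' L'`, constant term of `ι(u)·L`;
* `sharpPoly_zero_even_and_odd`, `flatPoly_zero_even_and_odd` (+ `_of_even/_of_odd`) — at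
  `a_p = 0`: `u_{2k} = 0`, `u_{2k+1} = (−1)^k ω⁺_{2k+1}`, `v_{2k} = (−1)^k ω⁻_{2k}`, `v_{2k+1} = 0`;
* `isSprungPair_zero_iff` — **at `a_p = 0`, `IsSprungPair f p 0 L♯ L♭` is LITERALLY the pair of
  congruence clauses of the tree's Pollack fact** `pollack_exists_plusMinusPAdicLFunction`
  (`θ_n ≡ (−1)^{⌊n/2⌋+1} ω_n^+ L♯`, `n` odd; `θ_n ≡ (−1)^{⌊n/2⌋+1} ω_n^- L♭`, `n` even), i.e.
  `L♯ = L⁺`, `L♭ = L⁻` in POLLACK's labelling (Sprung 2017 §3.1: the ♯/♭ functions "directly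
  generalize" the `±` ones) — the vendored sign convention is the tree's;
* `exists_isSprungPair_of_pollack` (+ `_frobeniusTrace_`) — hence Sprung's existence statement
  (`Sprung2017.thm112_exists_isSprungPair`) at `a_p = 0` is a CONSEQUENCE of the tree's Pollack
  fact (kernel-checked consistency of the two vendored shapes).

The second consistency statement — the constant terms `L♯(0)`, `L♭(0)` = Sprung's table of special
values, i.e. (P•) on the real objects — is `Supersingular/SprungConstantTerm.lean`.

References: [Sprung2017] §3.1, Thm. 1.12, Cor. 4.4–4.5; [Pollack2003] Thm. 5.6, Cor. 5.11, Prop. 6.18.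
-/

set_option autoImplicit false

noncomputable section

open scoped Classical MatrixGroups ModularForm

open CongruenceSubgroup Polynomial WeierstrassCurve Literature.NumberTheory.EllipticCurves
  Literature.NumberTheory.EllipticCurves.ModularForms
  Literature.NumberTheory.EllipticCurves.Sprung2017

namespace Summit.BirchSwinnertonDyer.Rank1Residual.Supersingular

/-! ### Transport of congruences -/

section Transport

variable {p : ℕ} [Fact p.Prime]

/-- `toIwasawa p u` is the coercion to `ℤ_p⟦T⟧` of `u.map (ℤ → ℤ_p)` — the form in which
`IsCongrModOmega` multiplies `ω ∈ ℤ[T]` into `Λ`. [folklore] -/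
theorem toIwasawa_apply (u : ℤ[X]) :
    toIwasawa p u = ((u.map (Int.castRingHom ℤ_[p]) : ℤ_[p][X]) : PowerSeries ℤ_[p]) := rfl

/-- A congruence `θ ≡ ω·L (mod ω_n)` in `Λ ⊗ ℚ_p` depends only on the product `ω·L ∈ Λ`:
if `ω·L = ω'·L'` then `θ ≡ ω L ⟺ θ ≡ ω' L'`. [folklore] -/
theorem isCongrModOmega_congr {n : ℕ} {θ : ℚ[X]} {ω ω' : ℤ[X]} {L L' : IwasawaAlgebra p}
    (h : toIwasawa p ω * L = toIwasawa p ω' * L') :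
    IsCongrModOmega p n θ ω L ↔ IsCongrModOmega p n θ ω' L' := by
  simp only [toIwasawa_apply] at h
  unfold IsCongrModOmega
  rw [h]

/-- The constant term of `ι(u)·L` for `u ∈ ℤ[T]`, `L ∈ Λ` is `u(0)·L(0)`. [folklore] -/
theorem constantCoeff_toIwasawa_mul (u : ℤ[X]) (L : IwasawaAlgebra p) :
    PowerSeries.constantCoeff (toIwasawa p u * L) =
      ((u.eval 0 : ℤ) : ℤ_[p]) * PowerSeries.constantCoeff L := by
  rw [map_mul, toIwasawa_apply, ← PowerSeries.coeff_zero_eq_constantCoeff_apply, Polynomial.coeff_coe,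
    Polynomial.coeff_map, Polynomial.coeff_zero_eq_eval_zero]
  simp

end Transport

/-! ### The recursion polynomials at `a_p = 0` -/

section ZeroTrace

variable (p : ℕ)

/-- At `a_p = 0`: `u_{2k} = 0` and `u_{2k+1} = (−1)^k ω⁺_{2k+1}`. [cite: Sprung2017, §3.1 (the ♯/♭ functions generalise Pollack's ±) and Cor. 4.4] -/
theorem sharpPoly_zero_even_and_odd (k : ℕ) :
    sharpPoly 0 p (2 * k) = 0 ∧
      sharpPoly 0 p (2 * k + 1) = (-1) ^ k * cyclotomicOmegaPlus p (2 * k + 1) := by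
  induction k with
  | zero =>
    refine ⟨sharpPoly_zero 0 p, ?_⟩
    rw [Nat.mul_zero, Nat.zero_add, sharpPoly_one, pow_zero, one_mul, cyclotomicOmegaPlus,
      show (1 : ℕ) / 2 = 0 from rfl, Finset.Icc_eq_empty (by omega), Finset.prod_empty]
  | succ k ih =>
    obtain ⟨h0, h1⟩ := ih
    have h2 : sharpPoly 0 p (2 * (k + 1)) = 0 := by
      rw [show 2 * (k + 1) = 2 * k + 2 from by ring, sharpPoly_add_two, h0, map_zero, zero_mul,
        mul_zero, sub_zero]
    refine ⟨h2, ?_⟩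
    rw [show 2 * (k + 1) + 1 = (2 * k + 1) + 2 from by ring, sharpPoly_add_two,
      show 2 * k + 1 + 1 = 2 * (k + 1) from by ring, h2, h1, mul_zero, zero_sub]
    have hω : cyclotomicOmegaPlus p (2 * k + 1 + 2) =
        cyclotomicOmegaPlus p (2 * k + 1) * (cyclotomic (p ^ (2 * (k + 1))) ℤ).comp (X + 1) := by
      simp only [cyclotomicOmegaPlus, show (2 * k + 1 + 2) / 2 = k + 1 from by omega,
        show (2 * k + 1) / 2 = k from by omega]
      rw [Finset.prod_Icc_succ_top (Nat.le_add_left 1 k)]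
    rw [hω, pow_succ]
    ring

/-- At `a_p = 0`: `v_{2k} = (−1)^k ω⁻_{2k}` and `v_{2k+1} = 0`. [cite: Sprung2017, §3.1 (the ♯/♭ functions generalise Pollack's ±) and Cor. 4.4] -/
theorem flatPoly_zero_even_and_odd (k : ℕ) :
    flatPoly 0 p (2 * k) = (-1) ^ k * cyclotomicOmegaMinus p (2 * k) ∧
      flatPoly 0 p (2 * k + 1) = 0 := by
  induction k with
  | zero =>
    refine ⟨?_, flatPoly_one 0 p⟩
    rw [Nat.mul_zero, flatPoly_zero, pow_zero, one_mul, cyclotomicOmegaMinus_zero]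
  | succ k ih =>
    obtain ⟨h0, h1⟩ := ih
    have h2 : flatPoly 0 p (2 * (k + 1)) = (-1) ^ (k + 1) * cyclotomicOmegaMinus p (2 * (k + 1)) := by
      rw [show 2 * (k + 1) = 2 * k + 2 from by ring, flatPoly_add_two, h1, h0, mul_zero, zero_sub]
      have hω : cyclotomicOmegaMinus p (2 * k + 2) =
          cyclotomicOmegaMinus p (2 * k) * (cyclotomic (p ^ (2 * k + 1)) ℤ).comp (X + 1) := by
        simp only [cyclotomicOmegaMinus, show (2 * k + 2 + 1) / 2 = k + 1 from by omega,
          show (2 * k + 1) / 2 = k from by omega]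
        rw [Finset.prod_Icc_succ_top (Nat.le_add_left 1 k),
          show 2 * (k + 1) - 1 = 2 * k + 1 from by omega]
      rw [hω, pow_succ]
      ring
    refine ⟨h2, ?_⟩
    rw [show 2 * (k + 1) + 1 = (2 * k + 1) + 2 from by ring, flatPoly_add_two,
      show 2 * k + 1 + 1 = 2 * (k + 1) from by ring, h2, h1, map_zero, zero_mul, mul_zero, sub_zero]

/-- `u_n = 0` for even `n` at `a_p = 0`. [cite: Sprung2017, Cor. 4.4] -/
theorem sharpPoly_zero_of_even {n : ℕ} (hn : Even n) : sharpPoly 0 p n = 0 := by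
  obtain ⟨k, rfl⟩ := hn
  rw [← two_mul]
  exact (sharpPoly_zero_even_and_odd p k).1

/-- `u_n = (−1)^{⌊n/2⌋} ω⁺_n` for odd `n` at `a_p = 0`. [cite: Sprung2017, Cor. 4.4] -/
theorem sharpPoly_zero_of_odd {n : ℕ} (hn : Odd n) :
    sharpPoly 0 p n = (-1) ^ (n / 2) * cyclotomicOmegaPlus p n := by
  obtain ⟨k, rfl⟩ := hn
  rw [show (2 * k + 1) / 2 = k from by omega]
  exact (sharpPoly_zero_even_and_odd p k).2

/-- `v_n = (−1)^{⌊n/2⌋} ω⁻_n` for even `n` at `a_p = 0`. [cite: Sprung2017, Cor. 4.4] -/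
theorem flatPoly_zero_of_even {n : ℕ} (hn : Even n) :
    flatPoly 0 p n = (-1) ^ (n / 2) * cyclotomicOmegaMinus p n := by
  obtain ⟨k, rfl⟩ := hn
  rw [← two_mul, show (2 * k) / 2 = k from by omega]
  exact (flatPoly_zero_even_and_odd p k).1

/-- `v_n = 0` for odd `n` at `a_p = 0`. [cite: Sprung2017, Cor. 4.4] -/
theorem flatPoly_zero_of_odd {n : ℕ} (hn : Odd n) : flatPoly 0 p n = 0 := by
  obtain ⟨k, rfl⟩ := hn
  exact (flatPoly_zero_even_and_odd p k).2

end ZeroTrace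

/-! ### At `a_p = 0` a Sprung pair is a Pollack pair (same labelling: `L♯ = L⁺`, `L♭ = L⁻`) -/

section Pollack

variable {N : ℕ} (f : CuspForm (Gamma0 N) 2) (p : ℕ) [Fact p.Prime]

/-- **At `a_p = 0`, Sprung's characterisation IS Pollack's pair of congruences** (Sprung 2017 §3.1;
Pollack 2003 Prop. 6.18 with the sign recorded in the tree): `IsSprungPair f p 0 L♯ L♭` iff
`θ_n ≡ (−1)^{⌊n/2⌋+1} ω_n^+ L♯ (mod ω_n)` for all odd `n` and `θ_n ≡ (−1)^{⌊n/2⌋+1} ω_n^- L♭ (mod ω_n)`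
for all even `n` — the two congruence clauses of `pollack_exists_plusMinusPAdicLFunction` with
`L⁺ = L♯`, `L⁻ = L♭`. [cite: Sprung2017, §3.1 and Cor. 4.4] [cite: Pollack2003, Prop. 6.18] -/
theorem isSprungPair_zero_iff (Lsharp Lflat : IwasawaAlgebra p) :
    IsSprungPair f p 0 Lsharp Lflat ↔
      (∀ n : ℕ, Odd n →
        IsCongrModOmega p n (mazurTateElement f p n)
          ((-1) ^ (n / 2 + 1) * cyclotomicOmegaPlus p n) Lsharp) ∧
      (∀ n : ℕ, Even n →
        IsCongrModOmega p n (mazurTateElement f p n)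
          ((-1) ^ (n / 2 + 1) * cyclotomicOmegaMinus p n) Lflat) := by
  -- at each level, the Sprung expression `−(u_n L♯ + v_n L♭)` is Pollack's `± ω_n^± L^±`
  have hodd : ∀ n : ℕ, Odd n →
      toIwasawa p (-1) * (toIwasawa p (sharpPoly 0 p n) * Lsharp + toIwasawa p (flatPoly 0 p n) * Lflat) =
        toIwasawa p ((-1) ^ (n / 2 + 1) * cyclotomicOmegaPlus p n) * Lsharp := by
    intro n hn
    rw [sharpPoly_zero_of_odd p hn, flatPoly_zero_of_odd p hn, map_zero, zero_mul, add_zero,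
      ← mul_assoc, ← map_mul, pow_succ]
    ring_nf
  have heven : ∀ n : ℕ, Even n →
      toIwasawa p (-1) * (toIwasawa p (sharpPoly 0 p n) * Lsharp + toIwasawa p (flatPoly 0 p n) * Lflat) =
        toIwasawa p ((-1) ^ (n / 2 + 1) * cyclotomicOmegaMinus p n) * Lflat := by
    intro n hn
    rw [sharpPoly_zero_of_even p hn, flatPoly_zero_of_even p hn, map_zero, zero_mul, zero_add,
      ← mul_assoc, ← map_mul, pow_succ]
    ring_nf
  constructor
  · intro h
    refine ⟨fun n hn ↦ ?_, fun n hn ↦ ?_⟩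
    · exact (isCongrModOmega_congr (hodd n hn)).mp (h n)
    · exact (isCongrModOmega_congr (heven n hn)).mp (h n)
  · rintro ⟨ho, he⟩ n
    rcases Nat.even_or_odd n with hn | hn
    · exact (isCongrModOmega_congr (heven n hn)).mpr (he n hn)
    · exact (isCongrModOmega_congr (hodd n hn)).mpr (ho n hn)

variable {W : WeierstrassCurve ℚ} [W.IsElliptic] [W.IsGloballyMinimal] [NeZero N] {f p}

omit [W.IsElliptic] in
/-- **Sprung's existence statement at `a_p = 0` follows from Pollack's theorem** (consistency of the
two vendored shapes): under the hypotheses of `pollack_exists_plusMinusPAdicLFunction` (odd good `p`,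
`a_p(E) = 0`, `f` the newform of `E`), Pollack's `(L⁺, L⁻)` is a Sprung pair for trace `0`.
[cite: Pollack2003, Thm. 5.6, Cor. 5.11 and Prop. 6.18] [cite: Sprung2017, §3.1 and Thm. 1.12] -/
theorem exists_isSprungPair_of_pollack
    (h : pollack_exists_plusMinusPAdicLFunction (W := W) (f := f) (p := p)) (hp : p ≠ 2)
    (hf : IsNewformOf W f) (hgood : W.HasGoodReductionAtPrime p) (hap : W.frobeniusTrace p = 0) :
    ∃ Lsharp Lflat : IwasawaAlgebra p, Lsharp ≠ 0 ∧ Lflat ≠ 0 ∧ IsSprungPair f p 0 Lsharp Lflat := by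
  obtain ⟨Lplus, Lminus, hLplus, hLminus, hodd, heven⟩ := h hp hf hgood hap
  exact ⟨Lplus, Lminus, hLplus, hLminus, (isSprungPair_zero_iff f p Lplus Lminus).mpr ⟨hodd, heven⟩⟩

omit [W.IsElliptic] in
/-- The same with the trace written as `W.frobeniusTrace p` (`= 0`), the form in which
`Sprung2017.thm112_exists_isSprungPair` concludes. [cite: Pollack2003, Prop. 6.18] [cite: Sprung2017, Thm. 1.12] -/
theorem exists_isSprungPair_frobeniusTrace_of_pollack
    (h : pollack_exists_plusMinusPAdicLFunction (W := W) (f := f) (p := p)) (hp : p ≠ 2)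
    (hf : IsNewformOf W f) (hgood : W.HasGoodReductionAtPrime p) (hap : W.frobeniusTrace p = 0) :
    ∃ Lsharp Lflat : IwasawaAlgebra p, IsSprungPair f p (W.frobeniusTrace p) Lsharp Lflat := by
  obtain ⟨Lsharp, Lflat, -, -, hSP⟩ := exists_isSprungPair_of_pollack h hp hf hgood hap
  exact ⟨Lsharp, Lflat, by rwa [hap]⟩

end Pollack

end Summit.BirchSwinnertonDyer.Rank1Residual.Supersingular

end
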